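import Mathlib
import HarnessLib
import Summits.HubbardSuperconductivity.HubbardSuperconductivity.Theorems.KLProgrammeKLRegimeEngineTowerImportP2Count
import Summits.HubbardSuperconductivity.HubbardSuperconductivity.Theorems.KLProgrammeKLRegimeEngineTowerImportXFloorPlain

/-!
# Route `KLProgramme` — crux K3 ENGINE (stmt-HubbardSuperconductivity-20437 `KLRegimeEngineV17F2`), row (X).1 / located risk #14 «S3 IN U-CURRENCY», brick (T3):
# the (X).1 QUARTIC ROW `‖W^{(j)}_4[K]‖_{Ωe} ≤ c₂·Klam|U|·2^j` FROM THE PLAIN FOUR-LEG LINE of `𝒱_j[K]` — the «≍ c·2^J» one-pinned-leg anisotropic count step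

Cell gate-hubbard-kl, seat hubbard-kl-k3c2-p3 (g16; row «sector-counting import (DR2000 L11/L12) for the leg-dress bar»).  The closing-map chain for (X).1's quartic
row asked by the registrant (p1b g17, KL STATUS 07:01:32Z 2026-08-29) is «row 7 (child 1, `quarticValueVariation_of_edgeClauses_explicit`) → (T2)
(`TorusFourierL2.plainFourLegLine_of_pairTransfer_superposition`: plain four-leg line `S₄`) → transfer × count → `LevelsUAt`'s quartic conjunct».  This file is the
third arrow, the four-leg twin of `…TowerReadoutSixCellPlain` (p693268): since `klAnisoLegKernelNormAt … j 4 Ωe = klLevNormOf … j 4 (𝒱_j[K]) Ωe` (`rfl`), it is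
(one-anchored anisotropic four-count `≤ klThinCountC·sectorCount j = 2·klThinCountC·2^j`, `card_bgmSectorSet_klAniso_anchored_le_doors`, p4) × (all-fixed anisotropic
four-leg pinned line `Bₐ` at `F_j`), and `Bₐ ≤ CA⁴·S₄` from the PLAIN line (`fixedTupleL1_klAniso_le_of_plain_klEng_legs`, `pinnedSum_le_of_fixedTupleL1_le_legs`, p690921):

* **`klAnisoLegKernelNormAt_four_le_of_line_doors`** — four-count doors + all-fixed line `Bₐ` ⇒ `klAnisoLegKernelNormAt … klE0 j 4 Ωe ≤ klThinCountC·sectorCount j·Bₐ` (every `Ωe`);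
* **`klAnisoLegKernelNormAt_four_le_of_plainLine_klEng`** — `∃ CA > 0`: stub binders + doors, `1 ≤ j ≤ nScales β + 1`, plain line `S₄` ⇒ `≤ 2·klThinCountC·(CA⁴·S₄)·2^j`;
* **`levelsU_quarticRow_of_plainLine_klEng`** — the (X).1 shape: if moreover `2·klThinCountC·(CA⁴·S₄) ≤ c₂·(P.Klam·|U|)` then
  `∀ Ωe, klAnisoLegKernelNormAt L M β U μ K klE0 j 4 Ωe ≤ c₂·(P.Klam·|U|)·2^j` — the first conjunct of `EngineV8.LevelsUAt L M c P β U μ K j` VERBATIM with `c 2 = c₂`.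
So the quartic row is `U`-currency exactly when the plain four-leg line is (`S₄ ≤ s·Klam|U|`, `n`-free `s`) — the `2^j` of the row IS the count's.  Proofs only (compositions
of landed theorems); the plain line `S₄` of `𝒱_j[K]` stays a hypothesis ((T2) reduces it to «(s1)(s2)(s3) + row 7»); nothing asserts (X).1, any stub, K3 or superconductivity.
References: BGM 2006 §2.7 (2.71a), §2.8 (2.76)–(2.80), (2.96)–(2.98), Lemma 2.5 [cite: BenfattoGiulianiMastropietro2006].
-/

noncomputable section

namespace Summit.HubbardSuperconductivity.HubbardSuperconductivity.Theorems.EngineV8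

set_option linter.dupNamespace false -- summit = problem name (single-conjunct summit), D-0017

open Classical
open Real Finset Literature.MathematicalPhysics.QuantumLattice Literature.Probability.LatticeModels GrassmannAlgebra
open Literature.MathematicalPhysics.QuantumLattice.FermiRG
open Summit.HubbardSuperconductivity.HubbardSuperconductivity.Theorems.KLRegimeSplit
open Summit.HubbardSuperconductivity.HubbardSuperconductivity.Theorems.KLProgrammeLegKernels
open Summit.HubbardSuperconductivity.HubbardSuperconductivity.Theorems.DispersionFlow
open Summit.HubbardSuperconductivity.HubbardSuperconductivity.Theorems.KLRegimeWick

variable {L M : ℕ} [NeZero L] [NeZero M]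

omit [NeZero M] in
/-- **THE FOUR-LEG LEVELLED NORM OF `𝒱_j[K]` FROM THE ALL-FIXED LINE, UNDER THE FOUR-COUNT DOORS**: for `R` with `0 ≤ R.Gfr j'`, `0 < c ≤ klThinCountC₃ R`,
`0 < U ≤ klThinCountU₀ R`, `klBetaMin ≤ β ≤ e^{c/U²}`, `μ ∈ klWindowC`, a frame with `FrameOK R U (nScales β) ν K`, and an all-fixed anisotropic four-leg pinned line
`Bₐ ≥ 0` of `𝒱_j[K]` sectorised with `F_j`: `klAnisoLegKernelNormAt L M β U μ K klE0 j 4 Ωe ≤ klThinCountC·sectorCount j·Bₐ` for EVERY prescription `Ωe`.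
[cite: BenfattoGiulianiMastropietro2006, §2.8 (2.76)-(2.80), (2.96)-(2.98)] -/
theorem klAnisoLegKernelNormAt_four_le_of_line_doors {R : RenConsts} (hR : ∀ j', 0 ≤ R.Gfr j') {c : ℝ} (hc : 0 < c)
    (hc₃ : c ≤ klThinCountC₃ R) {U : ℝ} (hU : 0 < U) (hU₀ : U ≤ klThinCountU₀ R) {β : ℝ} (hβ : klBetaMin ≤ β) (hβc : β ≤ Real.exp (c / U ^ 2))
    {μ : ℝ} (hμ : μ ∈ klWindowC) (ν : ℝ) {K : TrigPolyC4v} (hK : FrameOK R U (nScales β) ν K) (j : ℕ) {Bₐ : ℝ} (hB : 0 ≤ Bₐ)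
    (hline : ∀ Ω ∈ bgmSectorSet L M (klAnisoFamily L M β μ K klE0 j) 4, ∀ (p : Fin 4) (x : SpaceTimeIdx L M),
      imagTimeWeight β M ^ 3 * ∑ X ∈ univ.filter (fun X : Fin 4 → SpaceTimeIdx L M => X p = x),
        ‖sectorisedKernel L M β (klAnisoFamily L M β μ K klE0 j) (klEffectiveAction L M β U μ K klE0 j) 4 Ω X‖ ≤ Bₐ)
    (Ωe : Fin 4 → Option (SectorLeg (sectorCount j))) :
    klAnisoLegKernelNormAt L M β U μ K klE0 j 4 Ωe ≤ klThinCountC * sectorCount j * Bₐ := by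
  rw [← klLevNormOf_klEffectiveAction]
  exact klLevNormOf_four_le_thinCount_mul hR hc hc₃ hU hU₀ hβ hβc hμ ν hK j (klEffectiveAction L M β U μ K klE0 j) Ωe hB hline

/-- **THE FOUR-LEG LEVELLED NORM OF `𝒱_j[K]` FROM THE PLAIN FOUR-LEG LINE, UNDER THE STUB BINDERS**: `∃ CA > 0` absolute such that, under the stub binders (`P.WF`,
`R.WF2`, `c ≤ klEngC₃6`, `U ≤ klEngU₀9`, `klEngL₃`, `klEngM₃`, `FrameOK R U (nScales β) μ K`) and the four-count doors (`c ≤ klThinCountC₃ R`, `U ≤ klThinCountU₀ R`), for every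
level `1 ≤ j ≤ nScales β + 1` and `S₄ ≥ 0`: if for all spin/charge strings and every pin the plain four-leg kernel of `𝒱_j[K]` has `fixedTupleL1 β 3 … ≤ S₄`, then
`klAnisoLegKernelNormAt L M β U μ K klE0 j 4 Ωe ≤ 2·klThinCountC·(CA⁴·S₄)·2^j` for every `Ωe`.
[cite: BenfattoGiulianiMastropietro2006, §2.7 (2.71a), §2.8 (2.76)-(2.80), (2.96)-(2.98)] -/
theorem klAnisoLegKernelNormAt_four_le_of_plainLine_klEng :
    ∃ CA : ℝ, 0 < CA ∧ ∀ (P : SplitConsts) (R : RenConsts) (c : ℝ), P.WF → R.WF2 → 0 < c → c ≤ klEngC₃6 P R → c ≤ klThinCountC₃ R →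
      ∀ μ ∈ klWindowC, ∀ U : ℝ, 0 < U → U ≤ klEngU₀9 P R c → U ≤ klThinCountU₀ R → ∀ β : ℝ, klBetaMin ≤ β → β ≤ Real.exp (c / U ^ 2) →
      ∀ K : TrigPolyC4v, FrameOK R U (nScales β) μ K → ∀ (L M : ℕ) [NeZero L] [NeZero M],
      klEngL₃ β U ≤ L → klEngM₃ β U L ≤ M → ∀ j : ℕ, 1 ≤ j → j ≤ nScales β + 1 →
        ∀ S₄ : ℝ, 0 ≤ S₄ →
          (∀ (s c' : Fin 4 → Fin 2) (y₀ : SpaceTimeIdx L M),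
            fixedTupleL1 L M β 3 (sectorisedKernel L M β (trivialMultiplier L M) (klEffectiveAction L M β U μ K klE0 j) 4)
              (fun i => (((0 : Fin 1), s i), c' i)) y₀ ≤ S₄) →
          ∀ Ωe : Fin 4 → Option (SectorLeg (sectorCount j)),
            klAnisoLegKernelNormAt L M β U μ K klE0 j 4 Ωe ≤ 2 * klThinCountC * (CA ^ 4 * S₄) * (2 : ℝ) ^ j := by
  obtain ⟨CA, hCA, h⟩ := fixedTupleL1_klAniso_le_of_plain_klEng_legs
  refine ⟨CA, hCA, ?_⟩
  intro P R c hP hR2 hc hc6 hcT μ hμ U hU hU9 hUT β hβmin hβc K hK L M _ _ hL3 hM3 j hj hjN S₄ hS0 hS Ωe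
  have hRj : ∀ j', 0 ≤ R.Gfr j' := gfr_nonneg_of_wf2 hR2
  have hβ0 : β ≠ 0 := (lt_of_lt_of_le (by norm_num [klBetaMin]) hβmin).ne'
  have hB : 0 ≤ CA ^ 4 * S₄ := mul_nonneg (pow_nonneg hCA.le 4) hS0
  have key : klAnisoLegKernelNormAt L M β U μ K klE0 j 4 Ωe ≤ klThinCountC * sectorCount j * (CA ^ 4 * S₄) := by
    refine klAnisoLegKernelNormAt_four_le_of_line_doors hRj hc hcT hU hUT hβmin hβc hμ μ hK j hB ?_ Ωe
    intro Ω _ p x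
    -- the aniso all-fixed four-leg line at leg 0 from the plain line (`m = 3`), then any leg by translation invariance
    have hline0 : ∀ x₁ : SpaceTimeIdx L M,
        fixedTupleL1 L M β 3 (sectorisedKernel L M β (klAnisoFamily L M β μ K klE0 j) (klEffectiveAction L M β U μ K klE0 j) 4) Ω x₁ ≤ CA ^ 4 * S₄ := by
      intro x₁
      have hΩ : Ω = fun i => (((Ω i).1.1, (Ω i).1.2), (Ω i).2) := funext fun i => by simp
      rw [hΩ]
      exact h P R c hP hR2 hc hc6 μ hμ U hU hU9 β hβmin hβc K hK L M hL3 hM3 j hj hjN 3 (klEffectiveAction L M β U μ K klE0 j)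
        (fun i => (Ω i).1.1) (fun i => (Ω i).1.2) (fun i => (Ω i).2) S₄ hS0 (hS _ _) x₁
    exact pinnedSum_le_of_fixedTupleL1_le_legs hβ0 _ U μ K klE0 j Ω hline0 p x
  refine key.trans (le_of_eq ?_)
  have hsc : (sectorCount j : ℝ) = 2 * (2 : ℝ) ^ j := by
    unfold sectorCount
    push_cast
    ring
  rw [hsc]
  ring

/-- **THE (X).1 QUARTIC ROW FROM THE PLAIN FOUR-LEG LINE** — the first conjunct of `LevelsUAt L M c P β U μ K j` in its own shape: `∃ CA > 0` such that, under the stub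
binders and the four-count doors, for every `1 ≤ j ≤ nScales β + 1` and plain four-leg line `S₄ ≥ 0` of `𝒱_j[K]` with `2·klThinCountC·(CA⁴·S₄) ≤ c₂·(P.Klam·|U|)`:
`∀ Ωe, klAnisoLegKernelNormAt L M β U μ K klE0 j 4 Ωe ≤ c₂·(P.Klam·|U|)·2^j`.  The row is `U`-currency iff the plain line is: its `2^j` is the one-anchored count's.
[cite: BenfattoGiulianiMastropietro2006, §2.8 (2.96)-(2.98), Lemma 2.5] -/
theorem levelsU_quarticRow_of_plainLine_klEng :
    ∃ CA : ℝ, 0 < CA ∧ ∀ (P : SplitConsts) (R : RenConsts) (c : ℝ), P.WF → R.WF2 → 0 < c → c ≤ klEngC₃6 P R → c ≤ klThinCountC₃ R →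
      ∀ μ ∈ klWindowC, ∀ U : ℝ, 0 < U → U ≤ klEngU₀9 P R c → U ≤ klThinCountU₀ R → ∀ β : ℝ, klBetaMin ≤ β → β ≤ Real.exp (c / U ^ 2) →
      ∀ K : TrigPolyC4v, FrameOK R U (nScales β) μ K → ∀ (L M : ℕ) [NeZero L] [NeZero M],
      klEngL₃ β U ≤ L → klEngM₃ β U L ≤ M → ∀ j : ℕ, 1 ≤ j → j ≤ nScales β + 1 →
        ∀ S₄ c₂ : ℝ, 0 ≤ S₄ →
          (∀ (s c' : Fin 4 → Fin 2) (y₀ : SpaceTimeIdx L M),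
            fixedTupleL1 L M β 3 (sectorisedKernel L M β (trivialMultiplier L M) (klEffectiveAction L M β U μ K klE0 j) 4)
              (fun i => (((0 : Fin 1), s i), c' i)) y₀ ≤ S₄) →
          2 * klThinCountC * (CA ^ 4 * S₄) ≤ c₂ * (P.Klam * |U|) →
          ∀ Ωe : Fin 4 → Option (SectorLeg (sectorCount j)),
            klAnisoLegKernelNormAt L M β U μ K klE0 j 4 Ωe ≤ c₂ * (P.Klam * |U|) * (2 : ℝ) ^ j := by
  obtain ⟨CA, hCA, h⟩ := klAnisoLegKernelNormAt_four_le_of_plainLine_klEng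
  refine ⟨CA, hCA, ?_⟩
  intro P R c hP hR2 hc hc6 hcT μ hμ U hU hU9 hUT β hβmin hβc K hK L M _ _ hL3 hM3 j hj hjN S₄ c₂ hS0 hS hrow Ωe
  have h1 := h P R c hP hR2 hc hc6 hcT μ hμ U hU hU9 hUT β hβmin hβc K hK L M hL3 hM3 j hj hjN S₄ hS0 hS Ωe
  have h2 : (0 : ℝ) ≤ (2 : ℝ) ^ j := by positivity
  exact h1.trans (mul_le_mul_of_nonneg_right hrow h2)

end Summit.HubbardSuperconductivity.HubbardSuperconductivity.Theorems.EngineV8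

end
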